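import Literature.AlgebraicGeometry.Morphisms.CechModuleH2
import HarnessLib

/-!
# Vanishing of `Ȟ²(𝒰, M)` in the full ordered Čech complex for a family of at most two opens

Sequel of `Literature/AlgebraicGeometry/Morphisms/CechModuleH2.lean` (`Ȟ²(𝒰, M) = Ž²/B̌² = CechMH2 f M U`
of a sheaf of `𝒪_X`-modules `M` on a family of opens `𝒰 = (U_i)_{i ∈ ι}` of an `A`-scheme
`f : X → Spec A`, computed in the FULL ORDERED Čech complex: `Č²(𝒰, M) = Π_{(i,j,k) ∈ ι³} Γ(U_i ∩ U_j ∩ U_k, M)`,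
all ordered triples, degenerate ones included — The Stacks Project, Tag 01ED).

For a family indexed by a type with AT MOST TWO elements (`∀ i, i = a ∨ i = b`; e.g. `Fin 2`, `Bool`,
a one- or two-member open cover `X = U₀ ∪ U₁`), **every Čech `2`-cocycle is a `2`-coboundary**:
`Ȟ²(𝒰, M) = 0` for EVERY sheaf of modules `M` — no affineness, quasi-coherence, separatedness or
covering hypothesis is needed.  This is the degree-`2` instance of the comparison between the ordered
and the alternating Čech complex (The Stacks Project, Tag 01FG–01FM: the two complexes are homotopy
equivalent; the alternating complex of a family with `n` members vanishes in degrees `≥ n`), made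
explicit: for a `2`-cocycle `e` the `1`-cochain

  `c_{ij} = e_{jij}|_{U_i ∩ U_j}` if `j = a`,  `c_{ij} = e_{iii}|_{U_i ∩ U_j}` if `j ≠ a`

has `d¹ c = e` (`res_cechMD1_eq_res_of_two`, `exists_cechMD1_eq_of_two`): the eight components
`(i,j,k) ∈ {a,b}³` are the cocycle identities `d² e = 0` at the quadruples `(i,i,i,j)`, `(i,j,j,j)`
and `(a,b,a,b)` restricted to `U_i ∩ U_j ∩ U_k`.

* `res_cechMZ2_eq_zero` — the cocycle identity `e_{jkl} - e_{ikl} + e_{ijl} - e_{ijk} = 0` restricted to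
  any open `W ⊆ U_i ∩ U_j ∩ U_k ∩ U_l`; `res_cechMZ2_iij`, `res_cechMZ2_ijj` — its degenerate instances
  `e_{iij}| = e_{iii}|`, `e_{ijj}| = e_{jjj}|`;
* `res_cechMD1_eq_res_of_two`, `exists_cechMD1_eq_of_two` — the explicit primitive (no `def`: the
  `1`-cochain is characterised by `c_{ia} = e_{aia}|`, `c_{ij} = e_{iii}|` for `j ≠ a`);
* `cechMZ2_le_cechMB2_of_two`, **`subsingleton_cechMH2_of_two`** — `Ȟ²(𝒰, M) = 0` for `ι = {a, b}`;
  `subsingleton_cechMH2_of_card_le_two` (`Nat.card ι ≤ 2`, `ι` finite, possibly empty),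
  `subsingleton_cechMH2_fin_two` (`ι = Fin 2`), `subsingleton_cechMH2_bool` (`ι = Bool`).

Use (F-53 infrastructure, Görtz–Wedhorn II Cor. 24.44 in Čech form for PROJECTIVE `f` over a Noetherian
local ring with closed fibre of dimension `≤ 1`): `X` has a two-member affine open cover `𝒱`; by this
file `Ȟ²(𝒱, M) = 0`; degree-`2` affine-cover independence moves the vanishing to every finite affine
open cover.  Everything is proved; no named facts.  Mathlib searched (pin v4.32):
`CategoryTheory/Sites/SheafCohomology/Cech` (abstract Čech complex of a presheaf on a site; no
alternating comparison, no low-degree API); nothing on `X.Modules`.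

## What is NOT here

The general comparison ordered/alternating Čech complex (all degrees, all `n`); vanishing of `Ȟᵖ` for
`p ≥ n` on an `n`-member family for `n ≥ 3`.
`-- TODO(general form):` Stacks Tag 01FM (homotopy equivalence of the ordered and alternating Čech
complexes) in all degrees.

## References

* The Stacks Project, Tags 01ED (Cohomology, Section 20.9: the Čech complex), 01FG, 01FM
  (Cohomology, Section 20.23: the alternating Čech complex; Lemma 20.23.6 = Tag 01FM: the inclusion
  of the alternating into the ordered Čech complex is a homotopy equivalence — read in the held copy
  of the Stacks book, pp. 1832–1835). [StacksProject]
-/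

noncomputable section

open CategoryTheory AlgebraicGeometry Limits TopologicalSpace Opposite

universe u v

namespace Literature.AlgebraicGeometry.Morphisms

variable {A : Type u} [CommRing A] {X : Scheme.{u}} (f : X ⟶ Spec (.of A)) (M : X.Modules)
  {ι : Type v} (U : ι → X.Opens)

/-! ## The cocycle identity restricted to a smaller open -/

section Identities

variable {f M U}

/-- The `2`-cocycle identity `e_{jkl}| - e_{ikl}| + e_{ijl}| - e_{ijk}| = 0` of `e ∈ Ž²(𝒰, M)`, restricted
to any open `W ⊆ U_i ∩ U_j ∩ U_k ∩ U_l` (the four restriction proofs are arbitrary).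
[cite: StacksProject, Tag 01ED (Cohomology, Section 20.9)] -/
theorem res_cechMZ2_eq_zero {e : CechMC2 f M U} (he : e ∈ cechMZ2 f M U) (i j k l : ι)
    {W : X.Opens} (h₁ : W ≤ U j ⊓ U k ⊓ U l) (h₂ : W ≤ U i ⊓ U k ⊓ U l) (h₃ : W ≤ U i ⊓ U j ⊓ U l)
    (h₄ : W ≤ U i ⊓ U j ⊓ U k) :
    MSections.res f M h₁ (e j k l) - MSections.res f M h₂ (e i k l) +
      MSections.res f M h₃ (e i j l) - MSections.res f M h₄ (e i j k) = 0 := by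
  have hW : W ≤ U i ⊓ U j ⊓ U k ⊓ U l := le_inf h₄ (h₁.trans inf_le_right)
  have h := congrFun (congrFun (congrFun (congrFun ((mem_cechMZ2_iff f M U e).mp he) i) j) k) l
  rw [Pi.zero_apply, Pi.zero_apply, Pi.zero_apply, Pi.zero_apply, cechMD2_apply] at h
  have h' := congrArg (MSections.res f M hW) h
  simp only [map_sub, map_add, map_zero, MSections.res_res] at h'
  exact h'

/-- Degenerate instance `(i,i,i,j)` of the cocycle identity: `e_{iij}|_W = e_{iii}|_W` for
`W ⊆ U_i ∩ U_j`. [cite: StacksProject, Tag 01ED (Cohomology, Section 20.9)] -/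
theorem res_cechMZ2_iij {e : CechMC2 f M U} (he : e ∈ cechMZ2 f M U) (i j : ι) {W : X.Opens}
    (h₁ : W ≤ U i ⊓ U i ⊓ U j) (h₂ : W ≤ U i ⊓ U i ⊓ U i) :
    MSections.res f M h₁ (e i i j) = MSections.res f M h₂ (e i i i) := by
  have h := res_cechMZ2_eq_zero he i i i j h₁ h₁ h₁ h₂
  rwa [sub_self, zero_add, sub_eq_zero] at h

/-- Degenerate instance `(i,j,j,j)` of the cocycle identity: `e_{ijj}|_W = e_{jjj}|_W` for
`W ⊆ U_i ∩ U_j`. [cite: StacksProject, Tag 01ED (Cohomology, Section 20.9)] -/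
theorem res_cechMZ2_ijj {e : CechMC2 f M U} (he : e ∈ cechMZ2 f M U) (i j : ι) {W : X.Opens}
    (h₁ : W ≤ U i ⊓ U j ⊓ U j) (h₂ : W ≤ U j ⊓ U j ⊓ U j) :
    MSections.res f M h₁ (e i j j) = MSections.res f M h₂ (e j j j) := by
  have h := res_cechMZ2_eq_zero he i j j j h₂ h₁ h₁ h₁
  rw [sub_add_cancel, sub_eq_zero] at h
  exact h.symm

end Identities

/-! ## The explicit primitive of a `2`-cocycle on a family with at most two members -/

section TwoCover

/-- `U_i ∩ U_j ⊆ U_j ∩ U_i ∩ U_j`. [folklore] -/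
private theorem inf_le_jij (i j : ι) : U i ⊓ U j ≤ U j ⊓ U i ⊓ U j :=
  le_inf (le_inf inf_le_right inf_le_left) inf_le_right

/-- `U_i ∩ U_j ⊆ U_i ∩ U_i ∩ U_i`. [folklore] -/
private theorem inf_le_iii (i j : ι) : U i ⊓ U j ≤ U i ⊓ U i ⊓ U i :=
  le_inf (le_inf inf_le_left inf_le_left) inf_le_left

/-- `(d¹ c)_{ijk}|_W = e_{ijk}|_W` for every `W ⊆ U_i ∩ U_j ∩ U_k`, for a `2`-cocycle `e` on a
family indexed by a type with at most two elements `a`, `b` and any `1`-cochain `c` with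
`c_{ia} = e_{aia}|` and `c_{ij} = e_{iii}|` for `j ≠ a` (the degree-`2` piece of the homotopy
between the ordered and the alternating Čech complex, made explicit for two indices): the eight
cases `(i,j,k) ∈ {a,b}³` are the cocycle identities at `(i,i,i,j)`, `(i,j,j,j)`, `(a,b,a,b)`
restricted to `W`. [cite: StacksProject, Tag 01FM (Cohomology, Section 20.23)] -/
theorem res_cechMD1_eq_res_of_two (a b : ι) (hι : ∀ i, i = a ∨ i = b)
    {e : CechMC2 f M U} (he : e ∈ cechMZ2 f M U) (c : CechMC1 f M U)
    (hca : ∀ i, c i a = MSections.res f M (inf_le_jij U i a) (e a i a))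
    (hcn : ∀ i j, j ≠ a → c i j = MSections.res f M (inf_le_iii U i j) (e i i i))
    (i j k : ι) {W : X.Opens} (hW : W ≤ U i ⊓ U j ⊓ U k) :
    MSections.res f M hW (cechMD1 f M U c i j k) = MSections.res f M hW (e i j k) := by
  have hb : ∀ i, a ≠ i → b = i := fun i h => ((hι i).resolve_left fun h' => h h'.symm).symm
  have hi : W ≤ U i := hW.trans (inf_le_left.trans inf_le_left)
  have hj : W ≤ U j := hW.trans (inf_le_left.trans inf_le_right)
  have hk : W ≤ U k := hW.trans inf_le_right
  rw [cechMD1_apply]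
  rcases eq_or_ne a i with rfl | hia
  · rcases eq_or_ne a j with rfl | hja
    · rcases eq_or_ne a k with rfl | hka
      · -- `(a,a,a)`: trivial
        simp only [hca, map_sub, map_add, MSections.res_res]
        abel
      · -- `(a,a,b)`: identity `(a,a,a,b)`
        obtain rfl := hb k hka
        simp only [hca, hcn _ _ (Ne.symm hka), map_sub, map_add, MSections.res_res]
        rw [sub_self, zero_add]
        exact (res_cechMZ2_iij he a b hW (le_inf (le_inf hi hi) hi)).symm
    · obtain rfl := hb j hja
      rcases eq_or_ne a k with rfl | hka
      · -- `(a,b,a)`: trivial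
        simp only [hca, hcn _ _ (Ne.symm hja), map_sub, map_add, MSections.res_res]
        abel
      · -- `(a,b,b)`: identity `(a,b,b,b)`
        obtain rfl := hb k hka
        simp only [hcn _ _ (Ne.symm hka), map_sub, map_add, MSections.res_res]
        rw [sub_add_cancel]
        exact (res_cechMZ2_ijj he a b hW (le_inf (le_inf hk hk) hk)).symm
  · obtain rfl := hb i hia
    rcases eq_or_ne a j with rfl | hja
    · rcases eq_or_ne a k with rfl | hka
      · -- `(b,a,a)`: identity `(b,a,a,a)`
        simp only [hca, map_sub, map_add, MSections.res_res]
        rw [sub_add_cancel]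
        exact (res_cechMZ2_ijj he b a hW (le_inf (le_inf hj hj) hj)).symm
      · -- `(b,a,b)`: identity `(a,b,a,b)` with `(a,a,a,b)` and `(a,b,b,b)`
        obtain rfl := hb k hka
        simp only [hca, hcn _ _ (Ne.symm hka), map_sub, map_add, MSections.res_res]
        have G := res_cechMZ2_eq_zero he a b a b hW (le_inf (le_inf hj hj) hk)
          (le_inf (le_inf hj hk) hk) (le_inf (le_inf hj hk) hj)
        rw [res_cechMZ2_iij he a b (le_inf (le_inf hj hj) hk) (le_inf (le_inf hj hj) hj),
          res_cechMZ2_ijj he a b (le_inf (le_inf hj hk) hk) (le_inf (le_inf hk hk) hk)] at G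
        rw [eq_comm, ← sub_eq_zero, ← G]
        abel
    · obtain rfl := hb j hja
      rcases eq_or_ne a k with rfl | hka
      · -- `(b,b,a)`: identity `(b,b,b,a)`
        simp only [hca, hcn _ _ (Ne.symm hja), map_sub, map_add, MSections.res_res]
        rw [sub_self, zero_add]
        exact (res_cechMZ2_iij he b a hW (le_inf (le_inf hi hi) hi)).symm
      · -- `(b,b,b)`: trivial
        obtain rfl := hb k hka
        simp only [hcn _ _ (Ne.symm hka), map_sub, map_add, MSections.res_res]
        abel

/-- **Explicit primitive**: for a `2`-cocycle `e` on a family indexed by a type with at most two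
elements `a`, `b`, the `1`-cochain `c_{ij} = e_{jij}|_{U_i ∩ U_j}` if `j = a`, `c_{ij} = e_{iii}|_{U_i ∩ U_j}`
if `j ≠ a`, has `d¹ c = e`. [cite: StacksProject, Tag 01FM (Cohomology, Section 20.23)] -/
theorem exists_cechMD1_eq_of_two (a b : ι) (hι : ∀ i, i = a ∨ i = b) {e : CechMC2 f M U}
    (he : e ∈ cechMZ2 f M U) : ∃ c : CechMC1 f M U, cechMD1 f M U c = e := by
  classical
  obtain ⟨c, hca, hcn⟩ : ∃ c : CechMC1 f M U,
      (∀ i, c i a = MSections.res f M (inf_le_jij U i a) (e a i a)) ∧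
        ∀ i j, j ≠ a → c i j = MSections.res f M (inf_le_iii U i j) (e i i i) :=
    ⟨fun i j => if j = a then MSections.res f M (inf_le_jij U i j) (e j i j)
      else MSections.res f M (inf_le_iii U i j) (e i i i),
      fun i => if_pos rfl, fun i j hj => if_neg hj⟩
  refine ⟨c, ?_⟩
  funext i j k
  have h := res_cechMD1_eq_res_of_two f M U a b hι he c hca hcn i j k (le_refl _)
  rwa [MSections.res_self, MSections.res_self] at h

/-- **Every `2`-cocycle is a `2`-coboundary on a family with at most two members**: for
`U : ι → X.Opens` with `∀ i, i = a ∨ i = b` and every sheaf of `𝒪_X`-modules `M`,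
`Ž²(𝒰, M) ⊆ B̌²(𝒰, M)` in the full ordered Čech complex.
[cite: StacksProject, Tag 01FM (Cohomology, Section 20.23)] -/
theorem cechMZ2_le_cechMB2_of_two (a b : ι) (hι : ∀ i, i = a ∨ i = b) :
    cechMZ2 f M U ≤ cechMB2 f M U := fun e he =>
  (mem_cechMB2_iff f M U e).mpr (exists_cechMD1_eq_of_two f M U a b hι he)

/-- **`Ȟ²(𝒰, M) = 0` for a family of opens with at most two members** (full ordered Čech complex,
every sheaf of `𝒪_X`-modules `M`; in particular for a two-member open cover `X = U_a ∪ U_b`).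
[cite: StacksProject, Tag 01FM (Cohomology, Section 20.23)] -/
theorem subsingleton_cechMH2_of_two (a b : ι) (hι : ∀ i, i = a ∨ i = b) :
    Subsingleton (CechMH2 f M U) :=
  (subsingleton_cechMH2_iff f M U).mpr (cechMZ2_le_cechMB2_of_two f M U a b hι)

/-- `Ȟ²(𝒰, M) = 0` for a family of opens indexed by a finite type with at most two elements
(possibly empty). [cite: StacksProject, Tag 01FM (Cohomology, Section 20.23)] -/
theorem subsingleton_cechMH2_of_card_le_two [Finite ι] (hι : Nat.card ι ≤ 2) :
    Subsingleton (CechMH2 f M U) := by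
  rcases isEmpty_or_nonempty ι with h0 | ⟨⟨a⟩⟩
  · refine (subsingleton_cechMH2_iff f M U).mpr fun e _ => ?_
    rw [Subsingleton.elim e 0]
    exact zero_mem _
  · rcases Nat.lt_or_ge (Nat.card ι) 2 with hlt | hge
    · haveI : Subsingleton ι := Finite.card_le_one_iff_subsingleton.mp (by omega)
      exact subsingleton_cechMH2_of_two f M U a a fun i => Or.inl (Subsingleton.elim i a)
    · obtain ⟨b, -, hb⟩ := (Nat.card_eq_two_iff' a).mp (le_antisymm hι hge)
      exact subsingleton_cechMH2_of_two f M U a b fun i =>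
        (eq_or_ne i a).imp_right fun h => hb i h

/-- `Ȟ²(𝒰, M) = 0` for a family of two opens `U : Fin 2 → X.Opens` (e.g. `![U₀, U₁]`).
[cite: StacksProject, Tag 01FM (Cohomology, Section 20.23)] -/
theorem subsingleton_cechMH2_fin_two (U : Fin 2 → X.Opens) : Subsingleton (CechMH2 f M U) :=
  subsingleton_cechMH2_of_two f M U 0 1 (fun i => by fin_cases i <;> simp)

/-- `Ȟ²(𝒰, M) = 0` for a family of two opens indexed by `Bool`.
[cite: StacksProject, Tag 01FM (Cohomology, Section 20.23)] -/
theorem subsingleton_cechMH2_bool (U : Bool → X.Opens) : Subsingleton (CechMH2 f M U) :=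
  subsingleton_cechMH2_of_two f M U false true (fun i => by cases i <;> simp)

end TwoCover

end Literature.AlgebraicGeometry.Morphisms

end
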